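import Summits.ResolutionOfSingularities.ResolutionOfSingularities.Theorems.MarkedTransferCampaignW46ExitTreeIsolated
import HarnessLib

/-!
# Infinite branches of the marked quadratic tree, III: the monomial phase of one quadratic transform

[OURS · L1 W4.6 rung (i-a)′, INVARIANT layer — cell res-hironaka, LADDER-RESOLUTION rung L, D-0089; campaign s46,
seat res-D-pv-044 AS res-L1-s46-pv-8; host route MarkedTransfer, `--supports stmt-ResolutionOfSingularities-16156
--as helper`.] HONEST FRAMING: nothing here is a statement of H. Hironaka's manuscript (2017-03-23, [Hironaka2017]);
pure commutative algebra inside a field `K`. AI-written; weaker than expert review. No `sorry`; axioms standard.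
UNIVERSE: `K : Type` (continues `…ExitTreeIsolated.lean`).

The ENDGAME of the infinite-branch contradiction: once the marked ideal is a MONOMIAL `J = (w · p^α q^β)` in a regular
system of parameters `(p, q)` of `S` (`w` a unit), a first quadratic transform `S' ⊇ S[q/p]` carries the controlled
transform `(J S' : p^b S') = (w · p^{α+β-b} · t^β)` with `t = q/p` (`ctrlTransform_monomial_chart`); and either
`t ∈ 𝔪_{S'}` — then `(p, t)` is a regular system of parameters of `S'` (`maximalIdeal_eq_span_pair_of_div_mem`, the
"corner" point) and the monomial shape persists with exponents `(α+β-b, β)` — or `t` is a unit of `S'` (a "free"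
point) and the controlled transform is `(unit · p^{α+β-b})`. Also: divisors of a monomial in two non-associate primes
are monomials (`exists_eq_unit_mul_pow_mul_pow_of_dvd`), and the order of a monomial (`monomial_not_mem_pow`).

## References

* O. Zariski, P. Samuel, *Commutative Algebra* II (1960), Appendix 5. [ZariskiSamuel1960]
* C. Huneke, I. Swanson, *Integral Closure of Ideals, Rings, and Modules* (2006), §14.2 (p. 264). [HunekeSwanson2006]
-/

noncomputable section

open IsLocalRing Polynomial

-- single-problem summit: the doubled namespace component `ResolutionOfSingularities` is forced
set_option linter.dupNamespace false

namespace Summit.ResolutionOfSingularities.ResolutionOfSingularities.Theorems.CampaignW46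

open Literature.AlgebraicGeometry.Resolution

variable {K : Type} [Field K] {b : ℕ}

/-! ## Divisors and orders of monomials -/

/-- Divisors of `w · q^n` (`w` a unit, `q` prime) are `w' · q^β`. [folklore] -/
theorem exists_eq_unit_mul_pow_of_dvd {D : Type*} [CommRing D] [IsDomain D] {q w : D} (hq : Prime q)
    (hw : IsUnit w) : ∀ (n : ℕ) (z : D), z ∣ w * q ^ n → ∃ (β : ℕ) (w' : D), IsUnit w' ∧ β ≤ n ∧ z = w' * q ^ β := by
  intro n
  induction n with
  | zero =>
    intro z hz
    rw [pow_zero, mul_one] at hz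
    exact ⟨0, z, isUnit_of_dvd_unit hz hw, le_rfl, by rw [pow_zero, mul_one]⟩
  | succ n ih =>
    intro z hz
    have e : w * q ^ (n + 1) = (w * q ^ n) * q := by rw [pow_succ, mul_assoc]
    rw [e] at hz
    by_cases hqz : q ∣ z
    · obtain ⟨z', rfl⟩ := hqz
      have hz' : z' ∣ w * q ^ n := by
        rw [mul_comm (w * q ^ n) q] at hz
        exact (mul_dvd_mul_iff_left hq.ne_zero).mp hz
      obtain ⟨β, w', hw', hβ, rfl⟩ := ih z' hz'
      exact ⟨β + 1, w', hw', by omega, by rw [pow_succ]; ring⟩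
    · obtain ⟨k, hk⟩ := hz
      have hqk : q ∣ k := by
        have : q ∣ z * k := ⟨w * q ^ n, by rw [← hk, mul_comm]⟩
        exact (hq.dvd_or_dvd this).resolve_left hqz
      obtain ⟨k', rfl⟩ := hqk
      have hz' : z ∣ w * q ^ n := ⟨k', mul_right_cancel₀ hq.ne_zero (by rw [hk]; ring)⟩
      obtain ⟨β, w', hw', hβ, rfl⟩ := ih z hz'
      exact ⟨β, w', hw', by omega, rfl⟩

/-- **Divisors of a monomial**: in a domain, a divisor of `w · p^m · q^n` (`w` a unit, `p`, `q` primes) is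
`w' · p^α · q^β` with `w'` a unit, `α ≤ m`, `β ≤ n`. [folklore] -/
theorem exists_eq_unit_mul_pow_mul_pow_of_dvd {D : Type*} [CommRing D] [IsDomain D] {p q w : D} (hp : Prime p)
    (hq : Prime q) (hw : IsUnit w) :
    ∀ (m n : ℕ) (z : D), z ∣ w * p ^ m * q ^ n →
      ∃ (α β : ℕ) (w' : D), IsUnit w' ∧ α ≤ m ∧ β ≤ n ∧ z = w' * p ^ α * q ^ β := by
  intro m
  induction m with
  | zero =>
    intro n z hz
    rw [pow_zero, mul_one] at hz
    obtain ⟨β, w', hw', hβ, rfl⟩ := exists_eq_unit_mul_pow_of_dvd hq hw n z hz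
    exact ⟨0, β, w', hw', le_rfl, hβ, by rw [pow_zero, mul_one]⟩
  | succ m ih =>
    intro n z hz
    have e : w * p ^ (m + 1) * q ^ n = (w * p ^ m * q ^ n) * p := by rw [pow_succ]; ring
    rw [e] at hz
    by_cases hpz : p ∣ z
    · obtain ⟨z', rfl⟩ := hpz
      have hz' : z' ∣ w * p ^ m * q ^ n := by
        rw [mul_comm (w * p ^ m * q ^ n) p] at hz
        exact (mul_dvd_mul_iff_left hp.ne_zero).mp hz
      obtain ⟨α, β, w', hw', hα, hβ, rfl⟩ := ih n z' hz'
      exact ⟨α + 1, β, w', hw', by omega, hβ, by rw [pow_succ]; ring⟩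
    · obtain ⟨k, hk⟩ := hz
      have hpk : p ∣ k := by
        have : p ∣ z * k := ⟨w * p ^ m * q ^ n, by rw [← hk, mul_comm]⟩
        exact (hp.dvd_or_dvd this).resolve_left hpz
      obtain ⟨k', rfl⟩ := hpk
      have hz' : z ∣ w * p ^ m * q ^ n := ⟨k', mul_right_cancel₀ hp.ne_zero (by rw [hk]; ring)⟩
      obtain ⟨α, β, w', hw', hα, hβ, rfl⟩ := ih n z hz'
      exact ⟨α, β, w', hw', by omega, hβ, rfl⟩

section Order

variable {S : Subring K} [IsRegularLocalRing S] {p q : S}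

/-- The second parameter of a regular system `(p, q)` lies outside `𝔪²`. [folklore] -/
theorem snd_not_mem_sq (hdim : ringKrullDim S = 2) (hm : maximalIdeal S = Ideal.span {p, q}) :
    q ∉ maximalIdeal S ^ 2 :=
  fst_not_mem_sq hdim (by rw [hm, Set.pair_comm])

/-- **The order of a monomial**: `w · p^α q^β ∉ 𝔪^{α+β+1}` for a regular system of parameters `(p, q)` and a
unit `w`. [cite: ZariskiSamuel1960, Ch. VIII §1, Thm. 1] -/
theorem monomial_not_mem_pow (hdim : ringKrullDim S = 2) (hm : maximalIdeal S = Ideal.span {p, q}) {w : S}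
    (hw : IsUnit w) (α β : ℕ) : w * p ^ α * q ^ β ∉ maximalIdeal S ^ (α + β + 1) := by
  have hp2 : p ∉ maximalIdeal S ^ (1 + 1) := fst_not_mem_sq hdim hm
  have hq2 : q ∉ maximalIdeal S ^ (1 + 1) := snd_not_mem_sq hdim hm
  have hp1 : p ^ α ∉ maximalIdeal S ^ (α * 1 + 1) := pow_not_mem_pow_of_not_mem_pow hp2 α
  have hq1 : q ^ β ∉ maximalIdeal S ^ (β * 1 + 1) := pow_not_mem_pow_of_not_mem_pow hq2 β
  rw [mul_one] at hp1 hq1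
  have hpq := mul_not_mem_pow_of_not_mem_pow hp1 hq1
  rw [mul_assoc, Ideal.unit_mul_mem_iff_mem _ hw]
  exact hpq

/-- A monomial `w · p^α q^β` lies in `𝔪^k` iff `k ≤ α + β`. [folklore] -/
theorem monomial_mem_pow_iff (hdim : ringKrullDim S = 2) (hm : maximalIdeal S = Ideal.span {p, q}) {w : S}
    (hw : IsUnit w) (α β k : ℕ) : w * p ^ α * q ^ β ∈ maximalIdeal S ^ k ↔ k ≤ α + β := by
  have hpm : p ∈ maximalIdeal S := hm ▸ Ideal.subset_span (by simp)
  have hqm : q ∈ maximalIdeal S := hm ▸ Ideal.subset_span (by simp)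
  constructor
  · intro h
    by_contra hlt
    push Not at hlt
    exact monomial_not_mem_pow hdim hm hw α β (Ideal.pow_le_pow_right hlt h)
  · intro hk
    refine Ideal.pow_le_pow_right hk ?_
    rw [mul_assoc, pow_add]
    exact Ideal.mul_mem_left _ _ (Ideal.mul_mem_mul (Ideal.pow_mem_pow hpm α) (Ideal.pow_mem_pow hqm β))

/-- `(w · p^α q^β) ⊆ 𝔪^k` iff `k ≤ α + β`. [folklore] -/
theorem span_monomial_le_pow_iff (hdim : ringKrullDim S = 2) (hm : maximalIdeal S = Ideal.span {p, q}) {w : S}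
    (hw : IsUnit w) (α β k : ℕ) : Ideal.span {w * p ^ α * q ^ β} ≤ maximalIdeal S ^ k ↔ k ≤ α + β := by
  rw [Ideal.span_singleton_le_iff_mem, monomial_mem_pow_iff hdim hm hw]

omit [IsRegularLocalRing S] in
/-- If `(w · p^α q^β)` is not contained in `(p^b)` then `α < b`. [folklore] -/
theorem lt_of_span_monomial_not_le {w : S} {α β : ℕ}
    (h : ¬ Ideal.span {w * p ^ α * q ^ β} ≤ Ideal.span {p ^ b}) : α < b := by
  by_contra hle
  push Not at hle
  obtain ⟨m, rfl⟩ : ∃ m, α = b + m := ⟨α - b, by omega⟩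
  apply h
  rw [Ideal.span_singleton_le_span_singleton]
  exact Dvd.intro (w * p ^ m * q ^ β) (by rw [pow_add]; ring)

end Order

/-! ## One quadratic transform of a monomial ideal, on the chart of `p` -/

section Chart

variable {S : Subring K} [IsRegularLocalRing S] {p q : S}

omit [IsRegularLocalRing S] in
/-- For `z` in the chart ring `A = S[q/p]` there is `c ∈ S` with `z - c ∈ (q/p) A`. [folklore] -/
theorem exists_sub_mem_span_of_mem_chartAdjoin (z : chartAdjoin (K := K) p q) :
    ∃ c : S, z - chartIncl p q c ∈
      Ideal.span {(⟨((q : S) : K) / ((p : S) : K), Algebra.self_mem_adjoin_singleton S _⟩ : chartAdjoin (K := K) p q)} := by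
  obtain ⟨F, hF⟩ := exists_aeval_eq_of_mem_adjoin z.2
  obtain ⟨G, hG⟩ := X_dvd_sub_C (p := F)
  refine ⟨F.coeff 0, ?_⟩
  rw [Ideal.mem_span_singleton]
  refine ⟨⟨aeval (((q : S) : K) / ((p : S) : K)) G, Polynomial.aeval_mem_adjoin_singleton S _⟩, Subtype.ext ?_⟩
  change (z : K) - ((F.coeff 0 : S) : K) = ((q : S) : K) / ((p : S) : K) * aeval (((q : S) : K) / ((p : S) : K)) G
  have := congrArg (aeval (((q : S) : K) / ((p : S) : K))) hG
  rw [map_sub, aeval_C, map_mul, aeval_X, hF] at this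
  rw [← this]
  rfl

/-- **The corner point**: if `S' ⊇ A = S[q/p]` is a first quadratic transform of `(S, 𝔪 = (p, q))` and `t = q/p`
is a non-unit of `S'`, then `𝔪_{S'} = (p, t)` — the prime `Q = 𝔪_{S'} ∩ A` contains the maximal ideal `(p, t)A`
(`A/(p, t) = S/𝔪`). [cite: HunekeSwanson2006, §14.2 (p. 264)] -/
theorem maximalIdeal_eq_span_pair_of_div_mem (hm : maximalIdeal S = Ideal.span {p, q}) (hp0 : p ≠ 0)
    {S' : Subring K} [IsLocalRing S'] (h₁ : IsQuadraticTransform S S') (hle : chartAdjoin (K := K) p q ≤ S')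
    (ht : ((q : S) : K) / ((p : S) : K) ∈ S')
    (htm : (⟨((q : S) : K) / ((p : S) : K), ht⟩ : S') ∈ maximalIdeal S') :
    maximalIdeal S' = Ideal.span {Subring.inclusion hle (chartIncl p q p), ⟨((q : S) : K) / ((p : S) : K), ht⟩} := by
  have hpm : p ∈ maximalIdeal S := hm ▸ Ideal.subset_span (by simp)
  set A := chartAdjoin (K := K) p q with hAdef
  set tA : A := ⟨((q : S) : K) / ((p : S) : K), Algebra.self_mem_adjoin_singleton S _⟩ with htA
  set Q : Ideal A := (maximalIdeal S').comap (Subring.inclusion hle) with hQdef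
  haveI hQ : Q.IsPrime := Ideal.comap_isPrime _ _
  have hA : blowupRing S (p : K) = A := blowupRing_eq_adjoin hm
  have hR₁ : S' = (LocalSubring.ofPrime A Q).toSubring := h₁.eq_ofPrime_of_le hpm hp0 hA.le hle
  have hpQ : chartIncl (K := K) p q p ∈ Q := by
    rw [hQdef, Ideal.mem_comap]; exact (incl_mem_maximalIdeal_iff h₁.dominates p).mpr hpm
  have htQ : tA ∈ Q := by
    rw [hQdef, Ideal.mem_comap]
    exact htm
  -- `Q = (p, t)`
  have hQeq : Q = Ideal.span {chartIncl (K := K) p q p, tA} := by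
    apply le_antisymm
    · intro z hz
      obtain ⟨c, hc⟩ := exists_sub_mem_span_of_mem_chartAdjoin (p := p) (q := q) z
      by_cases hcm : c ∈ maximalIdeal S
      · -- `c ∈ (p, q) ⊆ (p, t) A` and `z - c ∈ (t)`
        have hcQ : chartIncl (K := K) p q c ∈ Ideal.span {chartIncl (K := K) p q p, tA} := by
          rw [hm, Ideal.mem_span_pair] at hcm
          obtain ⟨a₁, a₂, rfl⟩ := hcm
          rw [map_add, map_mul, map_mul]
          refine Ideal.add_mem _ (Ideal.mul_mem_left _ _ (Ideal.subset_span (by simp))) ?_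
          have hq : chartIncl (K := K) p q q = chartIncl p q p * tA := by
            apply Subtype.ext
            change ((q : S) : K) = ((p : S) : K) * (((q : S) : K) / ((p : S) : K))
            rw [mul_div_cancel₀ _ (fun e => hp0 (Subtype.ext e))]
          rw [hq, ← mul_assoc]
          exact Ideal.mul_mem_left _ _ (Ideal.subset_span (by simp))
        have : z = (z - chartIncl p q c) + chartIncl p q c := by ring
        rw [this]
        exact Ideal.add_mem _ (Ideal.span_mono (Set.singleton_subset_iff.mpr
          (Set.mem_insert_of_mem _ (Set.mem_singleton_iff.mpr rfl))) hc) hcQ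
      · -- `c` a unit: then `c = z - (z - c) ∈ Q`, impossible
        exfalso
        have hcQ' : chartIncl (K := K) p q c ∈ Q := by
          have : chartIncl (K := K) p q c = z - (z - chartIncl p q c) := by ring
          rw [this]
          exact Ideal.sub_mem _ hz ((Ideal.span_singleton_le_iff_mem _ |>.mpr htQ) hc)
        rw [hQdef, Ideal.mem_comap] at hcQ'
        exact hcm ((incl_mem_maximalIdeal_iff h₁.dominates c).mp hcQ')
    · rw [Ideal.span_le]
      rintro z (rfl | hz)
      · exact hpQ
      · rw [Set.mem_singleton_iff] at hz; subst hz; exact htQ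
  -- `𝔪_{S'} = Q S' = (p, t)`
  apply le_antisymm
  · intro z hz
    have hzL : (z : K) ∈ (LocalSubring.ofPrime A Q).toSubring := hR₁ ▸ z.2
    obtain ⟨a, s, hs, hz'⟩ := mem_ofPrime_iff.mp hzL
    have hs0 : ((s : A) : K) ≠ 0 := coe_ne_zero_of_not_mem hs
    have hsu : IsUnit (Subring.inclusion hle s) := by
      have : Subring.inclusion hle s ∉ maximalIdeal S' := fun h => hs (Ideal.mem_comap.mpr h)
      exact IsLocalRing.notMem_maximalIdeal.mp this
    obtain ⟨u, hu⟩ := hsu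
    have haQ : a ∈ Q := by
      rw [hQdef, Ideal.mem_comap]
      have e : Subring.inclusion hle a = z * Subring.inclusion hle s := by
        apply Subtype.ext
        change (a : K) = (z : K) * (s : K)
        rw [hz', div_mul_cancel₀ _ hs0]
      rw [e]
      exact Ideal.mul_mem_right _ _ hz
    rw [hQeq, Ideal.mem_span_pair] at haQ
    obtain ⟨c₁, c₂, hc⟩ := haQ
    have hz1 : z = (Subring.inclusion hle c₁ * ↑u⁻¹) * Subring.inclusion hle (chartIncl p q p) +
        (Subring.inclusion hle c₂ * ↑u⁻¹) * ⟨((q : S) : K) / ((p : S) : K), ht⟩ := by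
      have e1 : z * Subring.inclusion hle s = Subring.inclusion hle a := by
        apply Subtype.ext
        change (z : K) * (s : K) = (a : K)
        rw [hz', div_mul_cancel₀ _ hs0]
      have e2 : z = Subring.inclusion hle a * ↑u⁻¹ := by
        rw [← e1, ← hu, mul_assoc, Units.mul_inv, mul_one]
      have e3 : Subring.inclusion hle tA = ⟨((q : S) : K) / ((p : S) : K), ht⟩ := Subtype.ext rfl
      rw [e2, ← hc, map_add, map_mul, map_mul, e3]
      ring
    rw [hz1]
    exact Ideal.add_mem _ (Ideal.mul_mem_left _ _ (Ideal.subset_span (by simp)))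
      (Ideal.mul_mem_left _ _ (Ideal.subset_span (by simp)))
  · rw [Ideal.span_le]
    rintro z (rfl | hz)
    · exact Ideal.mem_comap.mp hpQ
    · rw [Set.mem_singleton_iff] at hz; subst hz; exact htm

/-- **The controlled transform of a monomial ideal on the chart of `p`**: for `J = (w · p^α q^β)` with
`b ≤ α + β` and a first quadratic transform `S' ⊇ S[q/p]`, `(J S' : (𝔪 S')^b) = (w · p^{α+β-b} · t^β)` with
`t = q/p`. [folklore] -/
theorem ctrlTransform_monomial_chart (hm : maximalIdeal S = Ideal.span {p, q}) (hp0 : p ≠ 0) {w : S}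
    {α β : ℕ} (hbn : b ≤ α + β) {S' : Subring K} (hle : chartAdjoin (K := K) p q ≤ S')
    (ht : ((q : S) : K) / ((p : S) : K) ∈ S') :
    ctrlTransform b S (Ideal.span {w * p ^ α * q ^ β}) S' =
      Ideal.span {Subring.inclusion ((subring_le_adjoin S _).trans hle) w *
        Subring.inclusion hle (chartIncl p q p) ^ (α + β - b) *
        (⟨((q : S) : K) / ((p : S) : K), ht⟩ : S') ^ β} := by
  have hSS' : S ≤ S' := (subring_le_adjoin S _).trans hle
  set p' : S' := Subring.inclusion hle (chartIncl p q p) with hp'def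
  set t' : S' := ⟨((q : S) : K) / ((p : S) : K), ht⟩ with ht'def
  have hp0K : ((p : S) : K) ≠ 0 := fun e => hp0 (Subtype.ext e)
  have hp'0 : p' ≠ 0 := fun e => hp0K (congrArg (fun z : S' => (z : K)) e)
  have hq' : Subring.inclusion hSS' q = p' * t' := by
    apply Subtype.ext
    change ((q : S) : K) = ((p : S) : K) * (((q : S) : K) / ((p : S) : K))
    rw [mul_div_cancel₀ _ hp0K]
  have hp'' : Subring.inclusion hSS' p = p' := Subtype.ext rfl
  -- `J S' = (w p^{α+β} t^β) = p^{α+β} · (w t^β)`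
  have hJ : extIdeal (Ideal.span {w * p ^ α * q ^ β}) S' =
      Ideal.span {p' ^ (α + β)} * Ideal.span {Subring.inclusion hSS' w * t' ^ β} := by
    rw [extIdeal_eq_map _ hSS', Ideal.map_span, Set.image_singleton, map_mul, map_mul, map_pow, map_pow, hq', hp'',
      Ideal.span_singleton_mul_span_singleton, mul_pow, pow_add]
    congr 1
    ext1
    ring_nf
  rw [ctrlTransform, hJ, extIdeal_maximalIdeal_eq_span hm hp0 hle, Ideal.span_singleton_pow,
    colon_span_pow_mul_eq hp'0 _ hbn, Ideal.span_singleton_mul_span_singleton]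
  congr 1
  ext1
  ring_nf

end Chart

end Summit.ResolutionOfSingularities.ResolutionOfSingularities.Theorems.CampaignW46

end
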